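import Summits.KontsevichZagierPeriods.KontsevichZagierPeriods.Theses.UnfoldedStokes
import Summits.KontsevichZagierPeriods.KontsevichZagierPeriods.Theorems.GpcLegendreLemniscatic.Negative.Canonical
import Literature.NumberTheory.Transcendental.KZLogCalculusProofs

/-!
# `LegendreAllModuli` (stmt-KontsevichZagierPeriods-3523) — line `Sketch` (card B shape, sphero-conal transport): skeleton

Crux (route UnfoldedStokes, rank 5): Legendre's relation `E K′ + E′ K − K K′ = π/2` at EVERY real
algebraic modulus `k ∈ (0,1)` INSIDE the four-move Kontsevich–Zagier calculus:
`KZ.Equivalent r r'` for `r = [(0,1)², e_k ⊗ κ_{k′} + e_{k′} ⊗ κ_k − κ_k ⊗ κ_{k′}]` and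
`r' = [ℝ, 1/(2(1+x²))]` (`κ_m(t) = ((1−t²)(1−mt²))^{-1/2}`, `e_m(t) = (1−mt²)^{1/2}(1−t²)^{-1/2}`,
parameter `m = k²`, `1 − m = k′²`).

## The line (lead's reshaping of `Cruxes/LegendreAllModuli/SketchIdeator1.lean`, card B
`cardB_line_shape : SwapSymmetrisation → (transport F_{k²} ⇝ F_0) → NodalFibreValue → crux`)

The composition idea of card B is kept — symmetrise by one swap, transport the one-representation
Legendre integrand `F_m = κ_m ⊗ e_{1−m} + e_m ⊗ κ_{1−m} − κ_m ⊗ κ_{1−m}` to the nodal fibre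
`F_0 = 1/√(1−x²)`, evaluate the nodal fibre — but the TRANSPORT is done by rule (2) instead of a
3-dimensional Newton–Leibniz band in the modulus: by the sphero-conal identity
(crux notes of stmt-0280, `Cruxes/GpcLegendreLemniscatic/SketchIdeator2g2.lean`, kernel-checked
`jacobianIdentity_holds`, `spheroConal_bijOn`) `F_m dx dy = Φ_m^*(dX dZ/√(1 − X² − Z²))` for
`Φ_m(x,y) = (x√(1−(1−m)y²), y√(1−mx²)) : (0,1)² ≅ Q` (open quarter disc), i.e. `F_m` is the area
form of the positive octant of `S²` in Jacobi's sphero-conal coordinates, for EVERY `m ∈ (0,1)`.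
So no `L¹`-estimate in the modulus, no Gauss–Manin certificate, no anchor fibre is needed.

Coordinates are written `z 0, z 1` on `Fin 2 → ℝ`.

* M1 `stub_symmetrise`: `[□, f_k] ~ [□, F_{k²}]` — `f_k − F_{k²} = h − h∘swap` with
  `h = e_{k′} ⊗ κ_k`; two integrand additivities around ONE swap (`IntegralRep.reindex`).
* M2a `stub_spheroConalChart` (lead): `Φ_m : (0,1)² ≅ Q` and the Jacobian identity (pure algebra);
* M2 `stub_octantTransfer` (lead): given M2a, ONE rule-(2) move along `Φ_m`,
  `[□, F_m] ~ [Q, (1 − X² − Z²)^{-1/2}]`, `Q = {X > 0, Z > 0, X² + Z² < 1}`; integrability of the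
  target transported by the Jacobian formula.
* M3 `stub_discToStrip`: ONE rule-(2) move along the one-coordinate substitution
  `Θ(s,y) = (s√(1−y²)/√(1+s²), y)` from the half-strip `H = {0 < z0} ∩ {0 < z1 < 1}` onto `Q`
  (Jacobian `√(1−y²)(1+s²)^{-3/2}`): `[Q, (1−X²−Z²)^{-1/2}] ~ [H, 1/(1+z0²)]`.
* M4 `stub_stripNewtonLeibniz`: ONE Newton–Leibniz move along `z1` (primitive `z1/(1+z0²)`) plus
  null faces: `[H, 1/(1+z0²)] ~ [(0,∞), 1/(1+y²)]` (verbatim the sibling crux's M3).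
* M5 `stub_halfLineTail`: `[(0,∞), 1/(1+y²)] ~ arctanRep` (verbatim the sibling crux's M4).

Composition `LegendreAllModuli_of`: `r ~ q ~ p ~ s ~ a ~ arctanRep ~ r'` (the last step is the
identity change of variables `equivalent_of_eqOn`, since `r'.domain = univ`).

Stubs are stated with EXPLICIT terms (no new definitions; `unitSq`, `arctanRep`,
`equivalent_of_eqOn` are the landed vocabulary of `Theorems/GpcLegendreLemniscatic/Negative/Canonical`).
-/

noncomputable section

open MeasureTheory Set
open Literature.NumberTheory.Transcendental
open Literature.NumberTheory.Transcendental.KZ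
open Summit.KontsevichZagierPeriods.KontsevichZagierPeriods.Theses.UnfoldedStokes (LegendreAllModuli)
open Summit.KontsevichZagierPeriods.Grothendieck.GpcLegendreLemniscaticNegative

namespace Summit.KontsevichZagierPeriods.UnfoldedStokes.LegendreAllModuliLine

/-- **M1, swap symmetrisation**: for real algebraic `k ∈ (0,1)` the crux representation
`[(0,1)², e_k ⊗ κ_{k′} + e_{k′} ⊗ κ_k − κ_k ⊗ κ_{k′}]` is equivalent to the one-representation
Legendre representation `[(0,1)², F_{k²}]`, `F_m = κ_m ⊗ e_{1−m} + e_m ⊗ κ_{1−m} − κ_m ⊗ κ_{1−m}`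
(written verbatim as the `F m x` of route GaussManinCertificates' `LegendreSector`): the two
integrands differ by `h − h ∘ swap`, `h = e_{k′} ⊗ κ_k`, and `[□, h] − [□, h ∘ swap]` is the
coordinate swap (rule 2); two integrand additivities (rule 1b). [cite: KontsevichZagier2001, §1.2 rules (1)–(2)] -/
theorem stub_symmetrise :
    ∀ k : ℝ, IsAlgebraic ℚ k → 0 < k → k < 1 →
      ∀ r : IntegralRep 2, r.domain = unitSq →
        EqOn r.integrand (fun x => Real.sqrt (1 - k ^ 2 * x 0 ^ 2) / Real.sqrt (1 - x 0 ^ 2) /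
              Real.sqrt ((1 - x 1 ^ 2) * (1 - (1 - k ^ 2) * x 1 ^ 2)) +
            Real.sqrt (1 - (1 - k ^ 2) * x 0 ^ 2) / Real.sqrt (1 - x 0 ^ 2) /
              Real.sqrt ((1 - x 1 ^ 2) * (1 - k ^ 2 * x 1 ^ 2)) -
            1 / Real.sqrt ((1 - x 0 ^ 2) * (1 - k ^ 2 * x 0 ^ 2)) /
              Real.sqrt ((1 - x 1 ^ 2) * (1 - (1 - k ^ 2) * x 1 ^ 2))) unitSq →
        ∃ q : IntegralRep 2, q.domain = unitSq ∧
          EqOn q.integrand (fun x => 1 / Real.sqrt ((1 - x 0 ^ 2) * (1 - k ^ 2 * x 0 ^ 2)) *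
                (Real.sqrt (1 - (1 - k ^ 2) * x 1 ^ 2) / Real.sqrt (1 - x 1 ^ 2)) +
              Real.sqrt (1 - k ^ 2 * x 0 ^ 2) / Real.sqrt (1 - x 0 ^ 2) *
                (1 / Real.sqrt ((1 - x 1 ^ 2) * (1 - (1 - k ^ 2) * x 1 ^ 2))) -
              1 / Real.sqrt ((1 - x 0 ^ 2) * (1 - k ^ 2 * x 0 ^ 2)) *
                (1 / Real.sqrt ((1 - x 1 ^ 2) * (1 - (1 - k ^ 2) * x 1 ^ 2)))) unitSq ∧
          Equivalent r q := by
  sorry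

/-- **M2a, the sphero-conal chart** (pure real algebra of Jacobi's sphero-conal coordinates): for
`m ∈ (0,1)` the map `Φ_m(x,y) = (x√(1−(1−m)y²), y√(1−mx²))` is injective on the open square, maps it
ONTO the open quarter disc `Q` (inverse through the smaller root of `(1−m)b² − (1 − mX² + (1−m)Z²)b + Z²`),
and the one-representation Legendre integrand `F_m` is the pulled-back octant-area density:
`F_m(x,y) = (1 − X² − Z²)^{-1/2} · |det DΦ_m|`, `det DΦ_m = (1 − mx² − (1−m)y²)/(√(1−mx²)√(1−(1−m)y²))`,
because `1 − X² − Z² = (1−x²)(1−y²)`. [folklore] -/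
theorem stub_spheroConalChart :
    ∀ m : ℝ, m ∈ Ioo (0:ℝ) 1 →
      InjOn (fun x : Fin 2 → ℝ => (![x 0 * Real.sqrt (1 - (1 - m) * x 1 ^ 2), x 1 * Real.sqrt (1 - m * x 0 ^ 2)] : Fin 2 → ℝ)) unitSq ∧
        (fun x : Fin 2 → ℝ => (![x 0 * Real.sqrt (1 - (1 - m) * x 1 ^ 2), x 1 * Real.sqrt (1 - m * x 0 ^ 2)] : Fin 2 → ℝ)) '' unitSq =
          {w : Fin 2 → ℝ | 0 < w 0 ∧ 0 < w 1 ∧ w 0 ^ 2 + w 1 ^ 2 < 1} ∧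
        ∀ x ∈ unitSq,
          1 / Real.sqrt ((1 - x 0 ^ 2) * (1 - m * x 0 ^ 2)) * (Real.sqrt (1 - (1 - m) * x 1 ^ 2) / Real.sqrt (1 - x 1 ^ 2)) +
              Real.sqrt (1 - m * x 0 ^ 2) / Real.sqrt (1 - x 0 ^ 2) * (1 / Real.sqrt ((1 - x 1 ^ 2) * (1 - (1 - m) * x 1 ^ 2))) -
              1 / Real.sqrt ((1 - x 0 ^ 2) * (1 - m * x 0 ^ 2)) * (1 / Real.sqrt ((1 - x 1 ^ 2) * (1 - (1 - m) * x 1 ^ 2))) =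
            1 / Real.sqrt (1 - (x 0 * Real.sqrt (1 - (1 - m) * x 1 ^ 2)) ^ 2 - (x 1 * Real.sqrt (1 - m * x 0 ^ 2)) ^ 2) *
              |(1 - m * x 0 ^ 2 - (1 - m) * x 1 ^ 2) / (Real.sqrt (1 - m * x 0 ^ 2) * Real.sqrt (1 - (1 - m) * x 1 ^ 2))| := by
  sorry

/-- **M2, octant transfer** (Jacobi's sphero-conal coordinates): for real algebraic `m ∈ (0,1)`,
ONE rule-(2) move along `Φ_m(x,y) = (x√(1−(1−m)y²), y√(1−mx²))`, a bijection of `(0,1)²` onto the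
open quarter disc `Q` with `det DΦ_m = (1 − mx² − (1−m)y²)/(√(1−mx²)√(1−(1−m)y²)) > 0` and
`1 − X² − Z² = (1−x²)(1−y²)`, takes `[(0,1)², F_m]` to the octant-area representation
`[Q, (1 − X² − Z²)^{-1/2}]` (its integrability transported by the Jacobian formula).
Given the chart facts M2a. [cite: KontsevichZagier2001, §1.2 rule (2)] -/
theorem stub_octantTransfer :
    (∀ m : ℝ, m ∈ Ioo (0:ℝ) 1 →
      InjOn (fun x : Fin 2 → ℝ => (![x 0 * Real.sqrt (1 - (1 - m) * x 1 ^ 2), x 1 * Real.sqrt (1 - m * x 0 ^ 2)] : Fin 2 → ℝ)) unitSq ∧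
        (fun x : Fin 2 → ℝ => (![x 0 * Real.sqrt (1 - (1 - m) * x 1 ^ 2), x 1 * Real.sqrt (1 - m * x 0 ^ 2)] : Fin 2 → ℝ)) '' unitSq =
          {w : Fin 2 → ℝ | 0 < w 0 ∧ 0 < w 1 ∧ w 0 ^ 2 + w 1 ^ 2 < 1} ∧
        ∀ x ∈ unitSq,
          1 / Real.sqrt ((1 - x 0 ^ 2) * (1 - m * x 0 ^ 2)) * (Real.sqrt (1 - (1 - m) * x 1 ^ 2) / Real.sqrt (1 - x 1 ^ 2)) +
              Real.sqrt (1 - m * x 0 ^ 2) / Real.sqrt (1 - x 0 ^ 2) * (1 / Real.sqrt ((1 - x 1 ^ 2) * (1 - (1 - m) * x 1 ^ 2))) -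
              1 / Real.sqrt ((1 - x 0 ^ 2) * (1 - m * x 0 ^ 2)) * (1 / Real.sqrt ((1 - x 1 ^ 2) * (1 - (1 - m) * x 1 ^ 2))) =
            1 / Real.sqrt (1 - (x 0 * Real.sqrt (1 - (1 - m) * x 1 ^ 2)) ^ 2 - (x 1 * Real.sqrt (1 - m * x 0 ^ 2)) ^ 2) *
              |(1 - m * x 0 ^ 2 - (1 - m) * x 1 ^ 2) / (Real.sqrt (1 - m * x 0 ^ 2) * Real.sqrt (1 - (1 - m) * x 1 ^ 2))|) →
    ∀ m : ℝ, IsAlgebraic ℚ m → m ∈ Ioo (0:ℝ) 1 →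
      ∀ q : IntegralRep 2, q.domain = unitSq →
        EqOn q.integrand (fun x => 1 / Real.sqrt ((1 - x 0 ^ 2) * (1 - m * x 0 ^ 2)) *
              (Real.sqrt (1 - (1 - m) * x 1 ^ 2) / Real.sqrt (1 - x 1 ^ 2)) +
            Real.sqrt (1 - m * x 0 ^ 2) / Real.sqrt (1 - x 0 ^ 2) *
              (1 / Real.sqrt ((1 - x 1 ^ 2) * (1 - (1 - m) * x 1 ^ 2))) -
            1 / Real.sqrt ((1 - x 0 ^ 2) * (1 - m * x 0 ^ 2)) *
              (1 / Real.sqrt ((1 - x 1 ^ 2) * (1 - (1 - m) * x 1 ^ 2)))) unitSq →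
        ∃ p : IntegralRep 2, p.domain = {w : Fin 2 → ℝ | 0 < w 0 ∧ 0 < w 1 ∧ w 0 ^ 2 + w 1 ^ 2 < 1} ∧
          EqOn p.integrand (fun w => 1 / Real.sqrt (1 - w 0 ^ 2 - w 1 ^ 2))
            {w : Fin 2 → ℝ | 0 < w 0 ∧ 0 < w 1 ∧ w 0 ^ 2 + w 1 ^ 2 < 1} ∧
          Equivalent q p := by
  sorry

/-- **M3, quarter disc to half-strip**: ONE rule-(2) move along the one-coordinate substitution
`Θ z = update z 0 (z0·√(1 − z1²)/√(1 + z0²))`, a bijection of the half-strip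
`H = {0 < z0} ∩ {0 < z1 < 1}` onto the quarter disc `Q` with Jacobian `√(1−z1²)·(1+z0²)^{-3/2}`;
since `1 − X² − Z² = (1 − z1²)/(1 + z0²)` along `Θ`, the pulled-back density is `1/(1 + z0²)`:
`[Q, (1−X²−Z²)^{-1/2}] ~ [H, 1/(1+z0²)]`. [cite: KontsevichZagier2001, §1.2 rule (2)] -/
theorem stub_discToStrip :
    ∀ p : IntegralRep 2, p.domain = {w : Fin 2 → ℝ | 0 < w 0 ∧ 0 < w 1 ∧ w 0 ^ 2 + w 1 ^ 2 < 1} →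
      EqOn p.integrand (fun w => 1 / Real.sqrt (1 - w 0 ^ 2 - w 1 ^ 2))
        {w : Fin 2 → ℝ | 0 < w 0 ∧ 0 < w 1 ∧ w 0 ^ 2 + w 1 ^ 2 < 1} →
      ∃ s : IntegralRep 2, s.domain = {z : Fin 2 → ℝ | 0 < z 0 ∧ 0 < z 1 ∧ z 1 < 1} ∧
        EqOn s.integrand (fun z => 1 / (1 + z 0 ^ 2)) {z : Fin 2 → ℝ | 0 < z 0 ∧ 0 < z 1 ∧ z 1 < 1} ∧
        Equivalent p s := by
  sorry

/-- **M4, Newton–Leibniz along the strip**: ONE rule-(3) move along the last coordinate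
`z1 = t ∈ [0,1]` with the primitive `F z = z1/(1 + z0²)` (polynomial in `t`), plus the null faces
`t = 0, 1` (rule 1a), takes the half-strip representation to the half-line representation
`[(0,∞), 1/(1 + y²)]`. [cite: KontsevichZagier2001, §1.2 rule (3)] -/
theorem stub_stripNewtonLeibniz :
    ∀ p : IntegralRep 2, p.domain = {z : Fin 2 → ℝ | 0 < z 0 ∧ 0 < z 1 ∧ z 1 < 1} →
      EqOn p.integrand (fun z => 1 / (1 + z 0 ^ 2)) {z : Fin 2 → ℝ | 0 < z 0 ∧ 0 < z 1 ∧ z 1 < 1} →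
      ∃ a : IntegralRep 1, a.domain = {y : Fin 1 → ℝ | 0 < y 0} ∧
        EqOn a.integrand (fun y => 1 / (1 + y 0 ^ 2)) {y : Fin 1 → ℝ | 0 < y 0} ∧
        Equivalent p a := by
  sorry

/-- **M5, half-line to line**: `[(0,∞), 1/(1 + y²)] ~ [ℝ, 1/(2(1 + y²))] = arctanRep` by the
reflection `y ↦ −y` (rule 2), halving the integrand (rule 1b), `ℝ = (−∞,0] ∪ (0,∞)`,
`(−∞,0] = (−∞,0) ∪ {0}` (rule 1a) and the null point `{0}`.
[cite: KontsevichZagier2001, §1.2 rules (1)–(2)] -/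
theorem stub_halfLineTail :
    ∀ a : IntegralRep 1, a.domain = {y : Fin 1 → ℝ | 0 < y 0} →
      EqOn a.integrand (fun y => 1 / (1 + y 0 ^ 2)) {y : Fin 1 → ℝ | 0 < y 0} →
      Equivalent a arctanRep := by
  sorry

/-- **Composition**: the five moves M1–M5 chain `r ~ q ~ p ~ s ~ a ~ arctanRep`, and the identity
change of variables `equivalent_of_eqOn` absorbs the crux's `∀ r'` shape (`r'.domain = univ`,
integrand `1/(2(1+x²))` on it); `m = k²` is algebraic and lies in `(0,1)`. [folklore] -/
theorem LegendreAllModuli_of : LegendreAllModuli := by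
  intro k hk hk0 hk1 r r' hrd hri hr'd hr'i
  have hm : IsAlgebraic ℚ (k ^ 2) := hk.pow 2
  have hm01 : k ^ 2 ∈ Ioo (0:ℝ) 1 := ⟨by positivity, by nlinarith⟩
  have hrd' : r.domain = unitSq := hrd
  have hri' := hri
  rw [hrd'] at hri'
  obtain ⟨q, hqd, hqi, hq⟩ := stub_symmetrise k hk hk0 hk1 r hrd' hri'
  obtain ⟨p, hpd, hpi, hp⟩ := stub_octantTransfer stub_spheroConalChart (k ^ 2) hm hm01 q hqd hqi
  obtain ⟨s, hsd, hsi, hs⟩ := stub_discToStrip p hpd hpi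
  obtain ⟨a, had, hai, ha⟩ := stub_stripNewtonLeibniz s hsd hsi
  have h5 : Equivalent a arctanRep := stub_halfLineTail a had hai
  have h6 : Equivalent arctanRep r' := by
    refine equivalent_of_eqOn arctanRep r' (show r'.domain = arctanRep.domain from hr'd) fun x _ => ?_
    have hx : x ∈ r'.domain := by rw [hr'd]; trivial
    show arctanRep.integrand x = r'.integrand x
    exact (hr'i hx).symm
  exact hq.trans (hp.trans (hs.trans (ha.trans (h5.trans h6))))

end Summit.KontsevichZagierPeriods.UnfoldedStokes.LegendreAllModuliLine
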